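import Literature.AlgebraicGeometry.HodgeTheory.WeilSurfaceSquareTorus
import Literature.NumberTheory.EllipticCurves.WeierstrassAddHomPoints
import Literature.NumberTheory.EllipticCurves.AbelianVarietyBridgeFullProofs
import Literature.NumberTheory.EllipticCurves.UniformizationHolomorphic
import Literature.NumberTheory.EllipticCurves.ComplexTorusAddProofs
import Literature.AlgebraicGeometry.Motives.AbelianVarietyProduct
import Literature.AlgebraicGeometry.Motives.AbelianVarietyProductDimProofs
import Literature.AlgebraicGeometry.Motives.VarietiesDimensionProofs
import Literature.AlgebraicGeometry.Motives.SegreEmbedding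
import Literature.NumberTheory.Transcendental.AnalytificationSeparatedProofs
import Literature.Geometry.Kaehler.ComplexTorusCover
import Mathlib.Topology.Homeomorph.Lemmas
import HarnessLib

/-!
# `E_τ × E_τ` as a complex abelian surface, its companion endomorphism, and its analytification `ℂ²/(ℤ + τℤ)²`

Algebraic side of the construction of a **Weil-type abelian surface for every `ℚ(√-d)`**
(`Literature.AlgebraicGeometry.HodgeTheory.exists_weilType_abelianSurfaces`; Schoen, Compositio 114
(1998) §10 uses `E × E` with `E` CM; here ANY elliptic curve works thanks to the companion matrix):

* `WeilSquare.curveAV τ` — the Weierstrass cubic `E_τ` of the lattice `ℤ + τℤ` as a complex ABELIAN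
  VARIETY (the tree's `WeierstrassCurve.abelianVarietyOfAddHom` with the glued chord–tangent addition
  `addHom` and negation `negHom`, Silverman III.3.6), of dimension `1`; `WeilSquare.square τ = E_τ × E_τ`,
  of dimension `2`;
* `WeilSquare.psi d = ((0, -d), (1, 0))`, the COMPANION endomorphism `(P, Q) ↦ (-d·Q, P)` of `E × E`,
  with `ψ ∘ ψ = -d` (`psi_comp_psi`) — no complex multiplication is needed;
* `WeilSquare.sqMap`, `WeilSquare.torusMap` — the uniformisation `(φ, φ) : ℂ² → (E × E)(ℂ)`,
  `φ(z) = [℘(z), ℘'(z)/2, 1]`, and its descent to the torus `T_τ = ℂ²/(ℤ + τℤ)²`, a homeomorphism and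
  an ANALYTIFICATION (`isAnalytification_torusMap`; Silverman VI 3.6 (b), Serre GAGA §2 — verbatim the
  argument of `Literature/Barriers/HodgeConjecture/…EllipticCurveCubedModel` for the cube);
* `WeilSquare.sqMap_comp_weilEnd`, `WeilSquare.torusMap_mapMatrix` — **the test endomorphism `x + yψ`
  acts on `(E × E)(ℂ)`, through the uniformisation, by the integer matrix `WeilSquare.weilMatrix d x y`**
  (its rational representation): the addition theorem for `℘` (`PeriodPair.toPoint_add_holds`) makes
  `φ` a homomorphism for the group-SCHEME law (`WeierstrassCurve.lift_pointEquiv_comp_addHom_of_field`),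
  and homomorphisms of abelian varieties act additively on points.

Everything is proved; no named fact is introduced.

## References

* C. Schoen, Compositio Math. 114 (1998), §10. [Schoen1998HodgeWeilAddendum]
* J. H. Silverman, *The Arithmetic of Elliptic Curves* (2009), III.3.6, VI Prop. 3.6 (b). [SilvermanAEC2009]
* J.-P. Serre, GAGA (1956), §2 n°5. [SerreGAGA1956]
* H. Lange, Ch. Birkenhake, *Complex Abelian Varieties* (1992), §1.1.1–§1.1.2. [LangeBirkenhake1992]
-/

noncomputable section

open CategoryTheory MonoidalCategory CartesianMonoidalCategory AlgebraicGeometry Complex Metric Set Filter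
open scoped Manifold ContDiff Topology Classical MonObj
open Literature.AlgebraicGeometry.Motives Literature.AlgebraicGeometry.Motives.AlgPoints
open Literature.NumberTheory.Transcendental Literature.NumberTheory.EllipticCurves Literature.Geometry.Kaehler

namespace Literature.AlgebraicGeometry.HodgeTheory

namespace WeilSquare

/-! ### Evaluation of homomorphisms at points -/

section Eval

universe u

variable {k : Type u} [Field k] {T A : AbelianVariety k} {L : Type u} [Field L] [Algebra k L]

/-- **Homomorphisms of abelian varieties act additively on `L`-points**: evaluation at an `L`-point
`P` of `T` is a homomorphism `Hom(T, A) → A(L)` (for Mathlib's group law `Hom.commGroup` on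
`A(L) = Hom_k(Spec L, A)`: `P ≫ (f + g) = (P ≫ f) · (P ≫ g)`, `MonObj.comp_mul`; Mumford §4).
[cite: MumfordAV1970, §4] -/
def evHom (P : AlgPoints T.X L) : (T ⟶ A) →+ Additive (AlgPoints A.X L) where
  toFun f := Additive.ofMul (P ≫ f.hom.hom.hom)
  map_zero' := by
    change Additive.ofMul (P ≫ (1 : T.X ⟶ A.X)) = Additive.ofMul 1
    rw [MonObj.comp_one]
  map_add' f g := by
    change Additive.ofMul (P ≫ (f.hom * g.hom).hom.hom) =
      Additive.ofMul ((P ≫ f.hom.hom.hom) * (P ≫ g.hom.hom.hom))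
    rw [← MonObj.comp_mul]
    rfl

/-- Unfolding of `evHom`. [folklore] -/
theorem evHom_apply (P : AlgPoints T.X L) (f : T ⟶ A) : evHom P f = Additive.ofMul (P ≫ f.hom.hom.hom) := rfl

end Eval

/-! ### The lattice `ℤ + τℤ`, the elliptic curve `E_τ` as an abelian variety, and `E_τ × E_τ` -/

section Square

variable (τ : ℂ)

/-- `1, τ` are `ℝ`-linearly independent for `Im τ ≠ 0`. [folklore] -/
theorem linearIndependent_one_tau (hτ : τ.im ≠ 0) : LinearIndependent ℝ ![(1 : ℂ), τ] := by
  refine LinearIndependent.pair_iff.mpr fun s t hst ↦ ?_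
  rw [Complex.real_smul, Complex.real_smul, mul_one] at hst
  have him : t * τ.im = 0 := by simpa using congrArg Complex.im hst
  have ht : t = 0 := (mul_eq_zero.mp him).resolve_right hτ
  have hre : s = 0 := by simpa [ht] using congrArg Complex.re hst
  exact ⟨hre, ht⟩

variable (hτ : τ.im ≠ 0)

/-- **The period pair `(1, τ)`** of the lattice `ℤ + τℤ`. [cite: SilvermanAEC2009, VI §3] -/
def periodPair : PeriodPair := ⟨1, τ, linearIndependent_one_tau τ hτ⟩

/-- Membership in `ℤ + τℤ`. [folklore] -/
theorem mem_lattice_periodPair_iff (x : ℂ) :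
    x ∈ (periodPair τ hτ).lattice ↔ ∃ m n : ℤ, (m : ℂ) + n * τ = x := by
  rw [PeriodPair.mem_lattice]
  change (∃ m n : ℤ, (m : ℂ) * 1 + n * τ = x) ↔ _
  simp only [mul_one]

/-- **The elliptic curve `E_τ` as a complex abelian variety**: the smooth plane cubic of the lattice
`ℤ + τℤ` with the chord–tangent addition morphism (the tree's `abelianVarietyOfAddHom`).
[cite: SilvermanAEC2009, III.3.6] -/
def curveAV : AbelianVariety ℂ :=
  (periodPair τ hτ).curve.abelianVarietyOfAddHom (periodPair τ hτ).curve.addHom (periodPair τ hτ).curve.negHom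
    (periodPair τ hτ).curve.lift_pointEquiv_comp_addHom (periodPair τ hτ).curve.pointEquiv_comp_negHom_geom

/-- The underlying scheme of `E_τ` is the Weierstrass cubic. [folklore] -/
theorem curveAV_X : (curveAV τ hτ).X = (periodPair τ hτ).curve.scheme := rfl

/-- `dim E_τ = 1`. [cite: SilvermanAEC2009, III.3.1(c)] -/
theorem dim_curveAV : (curveAV τ hτ).dim = 1 :=
  schemeDim_eq_holds (periodPair τ hτ).curve.isSmoothProjective_scheme

/-- **The abelian surface `E_τ × E_τ`** (reducible, so that the product API applies syntactically).
[cite: Schoen1998HodgeWeilAddendum, §10] -/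
abbrev square : AbelianVariety ℂ := (curveAV τ hτ).prod (curveAV τ hτ)

/-- `dim (E_τ × E_τ) = 2`. [folklore] -/
theorem dim_square : (square τ hτ).dim = 2 := by
  rw [AbelianVariety.dim_prod, dim_curveAV]

/-- `E_τ × E_τ` is a smooth projective surface. [folklore] -/
theorem isSmoothProjective_square : IsSmoothProjective 2 (square τ hτ).X :=
  IsSmoothProjective.tensor_holds (periodPair τ hτ).curve.isSmoothProjective_scheme
    (periodPair τ hτ).curve.isSmoothProjective_scheme

/-! ### The uniformisation `ℂ² → (E × E)(ℂ)` -/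

/-- The uniformisation `z ↦ [℘(z), ℘'(z)/2, 1]` valued in the complex points of the abelian variety `E_τ`.
[cite: SilvermanAEC2009, VI Prop. 3.6 (b)] -/
def uE (z : ℂ) : ComplexPoints (curveAV τ hτ).X := (periodPair τ hτ).upoint z

/-- **`z ↦ [℘(z), ℘'(z)/2, 1]` is a homomorphism for the group-scheme law on `E(ℂ)`**: the addition
theorem for `℘` (`toPoint_add_holds`) and `⟨[P], [Q]⟩ ≫ addHom = [P + Q]` on `ℂ`-points.
[cite: SilvermanAEC2009, VI Prop. 3.6 (b)] -/
theorem uE_add (z w : ℂ) : uE τ hτ (z + w) = uE τ hτ z * uE τ hτ w := by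
  change (periodPair τ hτ).curve.pointEquiv ((periodPair τ hτ).toPoint (z + w)) =
    lift ((periodPair τ hτ).curve.pointEquiv ((periodPair τ hτ).toPoint z))
      ((periodPair τ hτ).curve.pointEquiv ((periodPair τ hτ).toPoint w)) ≫ (periodPair τ hτ).curve.addHom
  rw [PeriodPair.toPoint_add_holds (periodPair τ hτ) z w]
  exact ((periodPair τ hτ).curve.lift_pointEquiv_comp_addHom_of_field _ _).symm

/-- The uniformisation as a homomorphism `ℂ →+ E(ℂ)`. [cite: SilvermanAEC2009, VI Prop. 3.6 (b)] -/
def uHom : ℂ →+ Additive (ComplexPoints (curveAV τ hτ).X) :=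
  AddMonoidHom.mk' (fun z ↦ Additive.ofMul (uE τ hτ z)) fun z w ↦ by
    rw [uE_add]; rfl

/-- Unfolding of `uHom`. [folklore] -/
theorem uHom_apply (z : ℂ) : uHom τ hτ z = Additive.ofMul (uE τ hτ z) := rfl

/-- **The uniformisation of the square** `u ↦ (φ(u₀), φ(u₁)) ∈ (E × E)(ℂ)`. [cite: SilvermanAEC2009, VI Prop. 3.6 (b)] -/
def sqMap (u : Fin 2 → ℂ) : ComplexPoints (square τ hτ).X :=
  prodEquiv.symm (uE τ hτ (u 0), uE τ hτ (u 1))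

/-- `sqMap u = ⟨φ(u₀), φ(u₁)⟩`. [folklore] -/
theorem sqMap_eq_lift (u : Fin 2 → ℂ) : sqMap τ hτ u = lift (uE τ hτ (u 0)) (uE τ hτ (u 1)) := rfl

/-- **`sqMap u = sqMap u'` iff `u ≡ u'` modulo `(ℤ + τℤ)²`.** [cite: SilvermanAEC2009, VI Prop. 3.6 (b)] -/
theorem sqMap_eq_sqMap_iff {u u' : Fin 2 → ℂ} :
    sqMap τ hτ u = sqMap τ hτ u' ↔ ∀ a, u a - u' a ∈ (periodPair τ hτ).lattice := by
  constructor
  · intro h a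
    obtain ⟨h0, h1⟩ := Prod.ext_iff.mp (prodEquiv.symm.injective h)
    fin_cases a
    · exact PeriodPair.upoint_eq_upoint_iff.mp h0
    · exact PeriodPair.upoint_eq_upoint_iff.mp h1
  · intro h
    exact congrArg prodEquiv.symm (Prod.ext (PeriodPair.upoint_eq_upoint_iff.mpr (h 0))
      (PeriodPair.upoint_eq_upoint_iff.mpr (h 1)))

/-- **`sqMap` is onto.** [cite: SilvermanAEC2009, VI Prop. 3.6 (b)] -/
theorem sqMap_surjective : Function.Surjective (sqMap τ hτ) := by
  intro Q
  obtain ⟨u0, hu0⟩ := (periodPair τ hτ).upoint_surjective (prodEquiv Q).1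
  obtain ⟨u1, hu1⟩ := (periodPair τ hτ).upoint_surjective (prodEquiv Q).2
  refine ⟨![u0, u1], ?_⟩
  have e0 : (![u0, u1] : Fin 2 → ℂ) 0 = u0 := rfl
  have e1 : (![u0, u1] : Fin 2 → ℂ) 1 = u1 := rfl
  unfold sqMap uE
  rw [e0, e1, hu0, hu1, Prod.mk.eta, Equiv.symm_apply_apply]

/-- **`sqMap` is continuous.** [cite: SilvermanAEC2009, VI Prop. 3.6 (b)] -/
theorem continuous_sqMap : Continuous (sqMap τ hτ) :=
  continuous_prodEquiv_symm.comp
    ((((periodPair τ hτ).continuous_upoint).comp (continuous_apply 0)).prodMk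
      (((periodPair τ hτ).continuous_upoint).comp (continuous_apply 1)))

/-- **`sqMap` is a holomorphic family near every point of `ℂ²`.** [cite: SerreGAGA1956, §2 n°5] -/
theorem exists_isHolFamilyOn_sqMap (u₀ : Fin 2 → ℂ) :
    ∃ U : Set (Fin 2 → ℂ), IsOpen U ∧ u₀ ∈ U ∧ IsHolFamilyOn U (sqMap τ hτ) := by
  choose ε hε hfam using fun a ↦ (periodPair τ hτ).exists_isHolFamilyOn_upoint (u₀ a)
  refine ⟨{u | ∀ a, u a ∈ ball (u₀ a) (ε a)}, ?_, fun a ↦ mem_ball_self (hε a), ?_⟩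
  · rw [Set.setOf_forall]
    exact isOpen_iInter_of_finite fun a ↦ isOpen_ball.preimage (continuous_apply a)
  · have hd : ∀ a : Fin 2, DifferentiableOn ℂ (fun u : Fin 2 → ℂ ↦ u a)
        {u : Fin 2 → ℂ | ∀ b, u b ∈ ball (u₀ b) (ε b)} := fun a u _ ↦
      (differentiableAt_apply (𝕜 := ℂ) a u).differentiableWithinAt
    have ha : ∀ a : Fin 2, IsHolFamilyOn {u : Fin 2 → ℂ | ∀ b, u b ∈ ball (u₀ b) (ε b)}
        ((periodPair τ hτ).upoint ∘ fun u : Fin 2 → ℂ ↦ u a) := fun a ↦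
      IsHolFamilyOn.comp (P' := Fin 2 → ℂ) (hfam a) (fun u : Fin 2 → ℂ ↦ u a) (hd a) (fun u hu ↦ hu a)
    exact (ha 0).prodMk (ha 1)

/-- Preimages of opens `W(ℂ)` under `sqMap` are open. [folklore] -/
theorem isOpen_preimage_sqMap (W : (square τ hτ).X.left.Opens) : IsOpen (sqMap τ hτ ⁻¹' {Q | Q.pt ∈ W}) :=
  (isOpen_setOf_pt_mem W).preimage (continuous_sqMap τ hτ)

/-- **Regular functions on `E × E` pull back to holomorphic functions on `ℂ²`.** [cite: SerreGAGA1956, §2 n°5] -/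
theorem differentiableOn_evalOrZero_sqMap (W : (square τ hτ).X.left.Opens) (g : Γ((square τ hτ).X.left, W)) :
    DifferentiableOn ℂ (fun u ↦ evalOrZero W g (sqMap τ hτ u)) (sqMap τ hτ ⁻¹' {Q | Q.pt ∈ W}) := by
  intro u₀ hu₀
  obtain ⟨U, hU, hu₀U, hfam⟩ := exists_isHolFamilyOn_sqMap τ hτ u₀
  have hd := hfam.differentiableOn_evalOrZero hU W g
  have hopen := hfam.isOpen_inter_preimage hU W
  exact (hd.differentiableAt (hopen.mem_nhds ⟨hu₀U, hu₀⟩)).differentiableWithinAt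

/-! ### Descent to the torus `T_τ = ℂ²/(ℤ + τℤ)²` -/

/-- **The lattice of `T_τ` is `(ℤ + τℤ)²`.** [cite: LangeBirkenhake1992, §1.1.1] -/
theorem cover_eq_cover_iff (z z' : Fin 2 → ℂ) :
    ComplexTorus.cover (periodIso τ hτ) z = ComplexTorus.cover (periodIso τ hτ) z' ↔
      ∀ a, z a - z' a ∈ (periodPair τ hτ).lattice := by
  have key : ∀ w : Fin 2 → ℂ, ComplexTorus.cover (periodIso τ hτ) w = ComplexTorus.cover (periodIso τ hτ) 0 ↔
      ∀ a, w a ∈ (periodPair τ hτ).lattice := by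
    intro w
    constructor
    · intro h
      have hp : ∀ p, ∃ n : ℤ, ((periodIso τ hτ).symm w p : ℝ) = n := by
        intro p
        have hp' := congrFun h p
        simp only [ComplexTorus.cover_apply, ComplexTorus.proj_apply, map_zero, Pi.zero_apply,
          QuotientAddGroup.mk_zero] at hp'
        obtain ⟨n, hn⟩ := (AddCircle.coe_eq_zero_iff (1 : ℝ)).mp hp'
        exact ⟨n, by rw [← hn, zsmul_eq_mul, mul_one]⟩
      choose N hN using hp
      have hw : w = periodIso τ hτ (fun p ↦ (N p : ℝ)) := by
        have : (periodIso τ hτ).symm w = fun p ↦ (N p : ℝ) := funext hN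
        rw [← this, ContinuousLinearEquiv.apply_symm_apply]
      intro a
      rw [mem_lattice_periodPair_iff]
      fin_cases a
      · refine ⟨N 0, N 1, ?_⟩
        rw [hw]
        change _ = periodIso τ hτ _ 0
        rw [periodIso_apply_zero]
        push_cast
        ring
      · refine ⟨N 2, N 3, ?_⟩
        rw [hw]
        change _ = periodIso τ hτ _ 1
        rw [periodIso_apply_one]
        push_cast
        ring
    · intro h
      obtain ⟨M0, N0, h0⟩ := (mem_lattice_periodPair_iff τ hτ (w 0)).mp (h 0)
      obtain ⟨M1, N1, h1⟩ := (mem_lattice_periodPair_iff τ hτ (w 1)).mp (h 1)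
      have hw : w = periodIso τ hτ ![(M0 : ℝ), (N0 : ℝ), (M1 : ℝ), (N1 : ℝ)] := by
        funext a
        fin_cases a
        · change w 0 = periodIso τ hτ _ 0
          rw [periodIso_apply_zero, ← h0]
          simp [mul_comm]
        · change w 1 = periodIso τ hτ _ 1
          rw [periodIso_apply_one, ← h1]
          simp [mul_comm]
      funext p
      rw [ComplexTorus.cover_apply, ComplexTorus.cover_apply, ComplexTorus.proj_apply,
        ComplexTorus.proj_apply, hw, ContinuousLinearEquiv.symm_apply_apply, map_zero, Pi.zero_apply,
        QuotientAddGroup.mk_zero, AddCircle.coe_eq_zero_iff]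
      fin_cases p
      · exact ⟨M0, by simp⟩
      · exact ⟨N0, by simp⟩
      · exact ⟨M1, by simp⟩
      · exact ⟨N1, by simp⟩
  -- reduce to `z' = 0` by translation
  have hsub : ComplexTorus.cover (periodIso τ hτ) z = ComplexTorus.cover (periodIso τ hτ) z' ↔
      ComplexTorus.cover (periodIso τ hτ) (z - z') = ComplexTorus.cover (periodIso τ hτ) 0 := by
    simp only [ComplexTorus.cover_apply, map_sub, map_zero]
    constructor
    · intro h
      funext p
      have hp := congrFun h p
      simp only [ComplexTorus.proj_apply, Pi.sub_apply, Pi.zero_apply] at hp ⊢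
      rw [AddCircle.coe_sub, hp, sub_self, QuotientAddGroup.mk_zero]
    · intro h
      funext p
      have hp := congrFun h p
      simp only [ComplexTorus.proj_apply, Pi.sub_apply, Pi.zero_apply, QuotientAddGroup.mk_zero,
        AddCircle.coe_sub, sub_eq_zero] at hp ⊢
      exact hp
  rw [hsub, key]
  simp only [Pi.sub_apply]

/-- **The comparison map `T_τ → (E × E)(ℂ)`**: `sqMap` on the standard lift of a point of the torus.
[cite: SilvermanAEC2009, VI Prop. 3.6 (b)] -/
def torusMap (t : Torus τ hτ) : ComplexPoints (square τ hτ).X :=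
  sqMap τ hτ (periodIso τ hτ (ComplexTorus.lift (periodIso τ hτ) t))

/-- **`torusMap ∘ π = sqMap`** for the covering map `π : ℂ² → T_τ`. [folklore] -/
theorem torusMap_cover (z : Fin 2 → ℂ) :
    torusMap τ hτ (ComplexTorus.cover (periodIso τ hτ) z) = sqMap τ hτ z := by
  apply (sqMap_eq_sqMap_iff τ hτ).mpr
  apply (cover_eq_cover_iff τ hτ _ _).mp
  rw [ComplexTorus.cover_apply, ContinuousLinearEquiv.symm_apply_apply, ComplexTorus.proj_lift]

/-- **`torusMap` is injective.** [cite: SilvermanAEC2009, VI Prop. 3.6 (b)] -/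
theorem torusMap_injective : Function.Injective (torusMap τ hτ) := by
  intro t t' h
  obtain ⟨z, rfl⟩ := ComplexTorus.cover_surjective (periodIso τ hτ) t
  obtain ⟨z', rfl⟩ := ComplexTorus.cover_surjective (periodIso τ hτ) t'
  rw [torusMap_cover, torusMap_cover] at h
  exact (cover_eq_cover_iff τ hτ z z').mpr ((sqMap_eq_sqMap_iff τ hτ).mp h)

/-- **`torusMap` is surjective.** [cite: SilvermanAEC2009, VI Prop. 3.6 (b)] -/
theorem torusMap_surjective : Function.Surjective (torusMap τ hτ) := by
  intro Q
  obtain ⟨u, rfl⟩ := sqMap_surjective τ hτ Q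
  exact ⟨ComplexTorus.cover (periodIso τ hτ) u, torusMap_cover τ hτ u⟩

/-- Over the domain of a chart of the torus, `torusMap = sqMap ∘ chart`. [folklore] -/
theorem sqMap_chartAt {t s : Torus τ hτ} (hs : s ∈ (chartAt (Fin 2 → ℂ) t).source) :
    sqMap τ hτ (chartAt (Fin 2 → ℂ) t s) = torusMap τ hτ s := by
  have hs' : ComplexTorus.cover (periodIso τ hτ) (chartAt (Fin 2 → ℂ) t s) = s := by
    rw [ComplexTorus.chartAt_eq, ← ComplexTorus.chart_symm_eq_cover (periodIso τ hτ)
      (ComplexTorus.corner (periodIso τ hτ) t)]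
    exact (ComplexTorus.chart (periodIso τ hτ) _).left_inv hs
  rw [← torusMap_cover, hs']

/-- **`torusMap` is continuous.** [folklore] -/
theorem continuous_torusMap : Continuous (torusMap τ hτ) := by
  refine continuous_iff_continuousAt.mpr fun t ↦ ?_
  have heq : (fun s ↦ sqMap τ hτ (chartAt (Fin 2 → ℂ) t s)) =ᶠ[𝓝 t] torusMap τ hτ := by
    filter_upwards [(chartAt (Fin 2 → ℂ) t).open_source.mem_nhds (mem_chart_source _ t)] with s hs
    exact sqMap_chartAt τ hτ hs
  refine ContinuousAt.congr ?_ heq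
  exact (continuous_sqMap τ hτ).continuousAt.comp ((chartAt (Fin 2 → ℂ) t).continuousAt (mem_chart_source _ t))

/-- **`torusMap : T_τ → (E × E)(ℂ)` is a homeomorphism** (continuous bijection, compact onto Hausdorff).
[cite: SilvermanAEC2009, VI Prop. 3.6 (b)] -/
theorem isHomeomorph_torusMap : IsHomeomorph (torusMap τ hτ) := by
  haveI : IsProper (square τ hτ).X.hom := IsSmoothProjective.isProper_holds (isSmoothProjective_square τ hτ)
  haveI : T2Space (ComplexPoints (square τ hτ).X) := ComplexPoints.t2Space_of_isSeparated _
  exact isHomeomorph_iff_continuous_bijective.mpr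
    ⟨continuous_torusMap τ hτ, torusMap_injective τ hτ, torusMap_surjective τ hτ⟩

/-- **`T_τ = ℂ²/(ℤ + τℤ)²` is the analytification of `E_τ × E_τ`.** [cite: SilvermanAEC2009, VI Prop. 3.6 (b)]
[cite: SerreGAGA1956, §2 n°5] -/
theorem isAnalytification_torusMap : IsAnalytification (Fin 2 → ℂ) (square τ hτ).X 2 (torusMap τ hτ) where
  isHomeomorph := isHomeomorph_torusMap τ hτ
  finrank_eq := by simp
  mdifferentiableOn_evalOrZero U s := by
    intro t ht
    refine MDifferentiableAt.mdifferentiableWithinAt ?_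
    rw [mdifferentiableAt_iff]
    refine ⟨?_, ?_⟩
    · exact ((continuousOn_evalOrZero _ s).continuousAt ((isOpen_setOf_pt_mem _).mem_nhds ht)).comp
        (continuous_torusMap τ hτ).continuousAt
    · have hw : writtenInExtChartAt 𝓘(ℂ, Fin 2 → ℂ) 𝓘(ℂ, ℂ) t (fun m ↦ evalOrZero (↑U) s (torusMap τ hτ m)) =
          fun z ↦ evalOrZero (↑U) s (sqMap τ hτ z) := by
        funext z
        simp only [writtenInExtChartAt, extChartAt_model_space_eq_id, PartialEquiv.refl_coe,
          Function.comp_apply, id_eq]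
        rw [ComplexTorus.extChartAt_symm_eq_cover, torusMap_cover]
      rw [hw]
      refine DifferentiableAt.differentiableWithinAt ?_
      have hz : sqMap τ hτ (extChartAt 𝓘(ℂ, Fin 2 → ℂ) t t) = torusMap τ hτ t := by
        rw [← torusMap_cover, ComplexTorus.cover_extChartAt_self]
      refine (differentiableOn_evalOrZero_sqMap τ hτ U s).differentiableAt ((isOpen_preimage_sqMap τ hτ U).mem_nhds ?_)
      change (sqMap τ hτ (extChartAt 𝓘(ℂ, Fin 2 → ℂ) t t)).pt ∈ (↑U : (square τ hτ).X.left.Opens)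
      rw [hz]
      exact ht

/-! ### The companion endomorphism and the action of `x + yψ` on the uniformisation -/

/-- **The companion endomorphism `ψ = ((0, -d), (1, 0))` of `E × E`**: `(P, Q) ↦ (-d·Q, P)`, the
companion matrix of `T² + d`. [cite: Schoen1998HodgeWeilAddendum, §10] -/
def psi (d : ℕ) : square τ hτ ⟶ square τ hτ :=
  AbelianVariety.prodLift (AbelianVariety.snd (curveAV τ hτ) (curveAV τ hτ) ≫ (-(d • 𝟙 (curveAV τ hτ))))
    (AbelianVariety.fst (curveAV τ hτ) (curveAV τ hτ))

/-- **`ψ ∘ ψ = -d`.** [cite: Schoen1998HodgeWeilAddendum, §10] -/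
theorem psi_comp_psi (d : ℕ) : psi τ hτ d ≫ psi τ hτ d = -(d • 𝟙 (square τ hτ)) := by
  unfold psi
  apply AbelianVariety.prod_hom_ext
  · rw [Category.assoc, AbelianVariety.prodLift_fst, ← Category.assoc, AbelianVariety.prodLift_snd]
    simp
  · rw [Category.assoc, AbelianVariety.prodLift_snd, AbelianVariety.prodLift_fst]
    simp

/-- `(x + yψ) ≫ pr₁ = x pr₁ - dy pr₂`. [folklore] -/
theorem weilEnd_fst (d x y : ℕ) :
    (x • 𝟙 (square τ hτ) + y • psi τ hτ d) ≫ AbelianVariety.fst (curveAV τ hτ) (curveAV τ hτ) =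
      x • AbelianVariety.fst (curveAV τ hτ) (curveAV τ hτ) - (y * d) • AbelianVariety.snd (curveAV τ hτ) (curveAV τ hτ) := by
  unfold psi
  simp [Preadditive.add_comp, mul_nsmul', sub_eq_add_neg]

/-- `(x + yψ) ≫ pr₂ = y pr₁ + x pr₂`. [folklore] -/
theorem weilEnd_snd (d x y : ℕ) :
    (x • 𝟙 (square τ hτ) + y • psi τ hτ d) ≫ AbelianVariety.snd (curveAV τ hτ) (curveAV τ hτ) =
      y • AbelianVariety.fst (curveAV τ hτ) (curveAV τ hτ) + x • AbelianVariety.snd (curveAV τ hτ) (curveAV τ hτ) := by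
  unfold psi
  simp [Preadditive.add_comp]
  exact add_comm _ _

/-- `pr₁ (sqMap u) = φ(u₀)`. [folklore] -/
theorem sqMap_fst (u : Fin 2 → ℂ) :
    evHom (A := curveAV τ hτ) (sqMap τ hτ u) (AbelianVariety.fst (curveAV τ hτ) (curveAV τ hτ)) = uHom τ hτ (u 0) := by
  rw [evHom_apply, uHom_apply, sqMap_eq_lift]
  exact congrArg Additive.ofMul (lift_fst _ _)

/-- `pr₂ (sqMap u) = φ(u₁)`. [folklore] -/
theorem sqMap_snd (u : Fin 2 → ℂ) :
    evHom (A := curveAV τ hτ) (sqMap τ hτ u) (AbelianVariety.snd (curveAV τ hτ) (curveAV τ hτ)) = uHom τ hτ (u 1) := by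
  rw [evHom_apply, uHom_apply, sqMap_eq_lift]
  exact congrArg Additive.ofMul (lift_snd _ _)

/-- **The endomorphism `x + yψ` acts on the uniformisation through the matrix `((x, -dy), (y, x))`**:
`(x + yψ)(φ(u₀), φ(u₁)) = (φ(x u₀ - dy u₁), φ(y u₀ + x u₁))` (`φ` is a homomorphism and
homomorphisms act additively on points). [cite: LangeBirkenhake1992, §1.1.2] -/
theorem sqMap_comp_weilEnd (d x y : ℕ) (u : Fin 2 → ℂ) :
    sqMap τ hτ u ≫ (x • 𝟙 (square τ hτ) + y • psi τ hτ d).hom.hom.hom =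
      sqMap τ hτ (weilLin d x y u) := by
  have e0 : weilLin d x y u 0 = x • u 0 - (y * d) • u 1 := by
    simp only [weilLin_apply_zero, nsmul_eq_mul, Int.cast_natCast, Nat.cast_mul]; ring
  have e1 : weilLin d x y u 1 = y • u 0 + x • u 1 := by
    simp only [weilLin_apply_one, nsmul_eq_mul, Int.cast_natCast]
  apply CartesianMonoidalCategory.hom_ext
  · have h1 := congrArg (evHom (A := curveAV τ hτ) (sqMap τ hτ u)) (weilEnd_fst τ hτ d x y)
    rw [map_sub, map_nsmul, map_nsmul, sqMap_fst, sqMap_snd, ← map_nsmul, ← map_nsmul, ← map_sub] at h1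
    have h2 := sqMap_fst τ hτ (weilLin d x y u)
    rw [evHom_apply] at h1 h2
    rw [e0] at h2
    have h' := congrArg Additive.toMul (h1.trans h2.symm)
    simp only [toMul_ofMul] at h'
    exact (Category.assoc _ _ _).trans h'
  · have h1 := congrArg (evHom (A := curveAV τ hτ) (sqMap τ hτ u)) (weilEnd_snd τ hτ d x y)
    rw [map_add, map_nsmul, map_nsmul, sqMap_fst, sqMap_snd, ← map_nsmul, ← map_nsmul, ← map_add] at h1
    have h2 := sqMap_snd τ hτ (weilLin d x y u)
    rw [evHom_apply] at h1 h2
    rw [e1] at h2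
    have h' := congrArg Additive.toMul (h1.trans h2.symm)
    simp only [toMul_ofMul] at h'
    exact (Category.assoc _ _ _).trans h'

/-- **The endomorphism `x + yψ` of `E_τ × E_τ` is, on the analytification `T_τ`, the homomorphism
`mapMatrix (weilMatrix d x y)`**: `torusMap (A·t) = (x + yψ)(torusMap t)`. [cite: LangeBirkenhake1992, §1.1.2] -/
theorem torusMap_mapMatrix (d x y : ℕ) (t : Torus τ hτ) :
    torusMap τ hτ (ComplexTorus.mapMatrix (periodIso τ hτ) (periodIso τ hτ) (weilMatrix d x y) t) =
      AlgPoints.map (x • 𝟙 (square τ hτ) + y • psi τ hτ d).hom.hom.hom (torusMap τ hτ t) := by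
  obtain ⟨z, rfl⟩ := ComplexTorus.cover_surjective (periodIso τ hτ) t
  rw [AlgPoints.map_apply, torusMap_cover, sqMap_comp_weilEnd, ComplexTorus.cover_apply,
    ComplexTorus.mapMatrix_proj]
  have h : ((weilMatrix (d : ℤ) x y).map (Int.cast : ℤ → ℝ)).mulVec ((periodIso τ hτ).symm z) =
      (periodIso τ hτ).symm (weilLin d x y z) := by
    apply (periodIso τ hτ).injective
    rw [periodIso_mulVec_weilMatrix, ContinuousLinearEquiv.apply_symm_apply,
      ContinuousLinearEquiv.apply_symm_apply]
  rw [h, ← ComplexTorus.cover_apply, torusMap_cover]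

end Square

end WeilSquare

end Literature.AlgebraicGeometry.HodgeTheory

end
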